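import Summits.ABC.ABC.Theses.IneffectiveSubspace

/-!
# Crux stmt-ABC-1649 `TowerFourSubLiouville` — round-2 ideator 4: typed edges and the CM-trident dictionary

No line is proposed (see `BarrierNotes-r2-k4.md`): every lever examined this round reduces to a catalogued
wall.  What is recorded here, kernel-checkable, is

* two NEW conditional edges placing the crux strictly below named conjectures weaker-looking than `ABC`:
  `SzpiroEdge` (polynomial Szpiro with ANY exponent `s < 8`; the enemy's Frey curve sits at Szpiro ratio `→ 8`)
  and `HallLangEdge` (Hall–Lang for the single CM family `y² = x³ + N x`, `j = 1728`); both are `Prop`s to be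
  PROVED by an idle prover `--supports stmt-ABC-1649` (like the landed Lang–Waldschmidt edge p111401);
* the "CM trident": an enemy `w Z⁴ = v Y⁴ + a` puts explicit INTEGRAL non-torsion points on the three CM curves
  `y² = x³ + (v w² a) x`, `y² = x³ − (v² w a) x`, `y² = x³ + (4 v w a²) x` (`trident_A/B/C`, proved by
  `linear_combination`), whence `L(E_N, 1) = 0` for all three by Coates–Wiles — a necessary condition on
  enemies, not a height bound.
-/

set_option linter.dupNamespace false

namespace Summit.ABC.ABC.Cruxes.TowerFourSubLiouville.Ideator4

open Summit.ABC.ABC.Theses.IneffectiveSubspace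
open Literature.NumberTheory.DiophantineGeometry (IsABCTriple rad)

/-- Polynomial Szpiro in abc-coordinates (`Δ_Frey = 16(abc)²`, `N_Frey ∣ 2⁸·rad(abc)`):
`(abc)² ≤ C · rad(abc)^s` for all abc triples.  `s = 6 + ε` is Szpiro's conjecture; every `s` is open. -/
def PolySzpiro (s : ℝ) : Prop :=
  ∃ C : ℝ, 0 < C ∧ ∀ a b c : ℕ, IsABCTriple a b c →
    (((a * b * c : ℕ) : ℝ)) ^ (2 : ℕ) ≤ C * ((rad a b c : ℕ) : ℝ) ^ s

/-- EDGE E1 (provable now, ≤ 80 lines: `abc ≥ c²/2` for a coprime triple and `rad(abc) ∣ Π`,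
`Negative.Framing.rad_dvd_towerProd`): Szpiro with ANY exponent `s < 8` gives `TowerIneq(4, s/4)`, `s/4 < 2`. -/
def SzpiroEdge : Prop := ∀ s : ℝ, s < 8 → PolySzpiro s → TowerFourSubLiouville

/-- Hall–Lang for the CM family `j = 1728`: integral points `(x, y)`, `y ≠ 0`, of `y² = x³ + N x` have
`|x| ≤ C · |N|^κ` (one absolute `κ`).  Implied by `ABC`; open for every `κ`. -/
def HallLang1728 : Prop :=
  ∃ κ C : ℝ, 0 < C ∧ ∀ N x y : ℤ, N ≠ 0 → y ≠ 0 → y ^ 2 = x ^ 3 + N * x →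
    (|x| : ℝ) ≤ C * (|N| : ℝ) ^ κ

/-- EDGE E2 (provable now, ~150 lines: `trident_A` + `bad_point_shape`/the landed `stub_transfer`
`UBQ η → crux` with `η < 1/(2κ + 2)`): Hall–Lang for `y² = x³ + N x` gives the crux. -/
def HallLangEdge : Prop := HallLang1728 → TowerFourSubLiouville

/-- Trident, curve A: `w Z⁴ = v Y⁴ + a` ⟹ `(v w Y², v w² Y Z²)` lies on `y² = x³ + (v w² a) x`. -/
theorem trident_A (v w Y Z a : ℤ) (h : w * Z ^ 4 = v * Y ^ 4 + a) :
    (v * w ^ 2 * Y * Z ^ 2) ^ 2 = (v * w * Y ^ 2) ^ 3 + (v * w ^ 2 * a) * (v * w * Y ^ 2) := by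
  linear_combination (v ^ 2 * w ^ 3 * Y ^ 2) * h

/-- Trident, curve B: `w Z⁴ = v Y⁴ + a` ⟹ `(v w Z², v² w Y² Z)` lies on `y² = x³ − (v² w a) x`. -/
theorem trident_B (v w Y Z a : ℤ) (h : w * Z ^ 4 = v * Y ^ 4 + a) :
    (v ^ 2 * w * Y ^ 2 * Z) ^ 2 = (v * w * Z ^ 2) ^ 3 + (-(v ^ 2 * w * a)) * (v * w * Z ^ 2) := by
  linear_combination (-(v ^ 3 * w ^ 2 * Z ^ 2)) * h

/-- Trident, curve C: `w Z⁴ = v Y⁴ + a` ⟹ `(4 v w Y² Z², 4 v w (w Z⁴ + v Y⁴) Y Z)` lies on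
`y² = x³ + (4 v w a²) x` (from `(wZ⁴ + vY⁴)² − 4vw(YZ)⁴ = a²`). -/
theorem trident_C (v w Y Z a : ℤ) (h : w * Z ^ 4 = v * Y ^ 4 + a) :
    (4 * v * w * (w * Z ^ 4 + v * Y ^ 4) * Y * Z) ^ 2 =
      (4 * v * w * Y ^ 2 * Z ^ 2) ^ 3 + (4 * v * w * a ^ 2) * (4 * v * w * Y ^ 2 * Z ^ 2) := by
  linear_combination (16 * v ^ 2 * w ^ 2 * Y ^ 2 * Z ^ 2 * (w * Z ^ 4 - v * Y ^ 4 + a)) * h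

/-- Unit slice (`a = 1`): the norm-one unit behind the enemy.  With `P = wZ⁴ + vY⁴`, `Q = Y²Z²`, `D = vw`:
`P² − 4 D Q² = a²`; for `a = 1` the element `P + 2Q√D` is a unit of `ℤ[√D]`, i.e. the enemy is a
Pell solution `x² − D y² = 1` with `y = 2(YZ)²`, `x + 1 = 2wZ⁴`, `x − 1 = 2vY⁴` (half-period datum of `√(vw)`). -/
theorem unitSlice_pell (v w Y Z a : ℤ) (h : w * Z ^ 4 = v * Y ^ 4 + a) :
    (w * Z ^ 4 + v * Y ^ 4) ^ 2 - (v * w) * (2 * Y ^ 2 * Z ^ 2) ^ 2 = a ^ 2 := by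
  linear_combination (w * Z ^ 4 - v * Y ^ 4 + a) * h

/-- Worked unit-slice points (census + one NEW, from the Pell-in-Pell family `X² − 3U² = 1`, `X` even,
`x₁ = X/2`, `D = (x₁² − 1)/36`, `ε_D³` doubly quartic): -/
example : (91 : ℤ) * 19 ^ 4 - 10 * 33 ^ 4 = 1 := by norm_num
example : (1261 : ℤ) * 71 ^ 4 - 140 * 123 ^ 4 = 1 := by norm_num
/-- … and `91·19⁴ − 10·33⁴ = 1` is the CUBE of the fundamental unit `181 + 6√910` (so index 3 occurs:
unit-slice index bounds must allow `n = 3`). -/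
example : ((181 : ℤ) ^ 3 + 3 * 181 * 6 ^ 2 * 910 = 2 * 91 * 19 ^ 4 - 1) ∧
    (3 * 181 ^ 2 * 6 + 6 ^ 3 * 910 = 2 * 33 ^ 2 * 19 ^ 2) := by norm_num

end Summit.ABC.ABC.Cruxes.TowerFourSubLiouville.Ideator4
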